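import Literature.NumberTheory.EllipticCurves.GreenbergVatsal2000.NonPrimitiveDatumSelmerInvariants
import Literature.NumberTheory.EllipticCurves.IwasawaSelmer
import HarnessLib

/-!
# Route `ThetaPartnerAtTwo`, crux K4 `SignedControlAtTwo`: the ONE local input the K4 door needs from weak-Leopoldt-type theory —
# «the Pontryagin dual of `H¹(K_Σ/K_∞, E[p^∞])` is not `Λ`-torsion» — as a NAMED PREDICATE (definition only)

Definitions file (reviewed; D-0026: definitions live apart from proof files) of line `eulerchar` (lead `prover-bsd-wall-tp2-p3` g3),
crux K4 `SignedControlAtTwo` (stmt-BirchSwinnertonDyer-20309; routes `ThetaPartnerAtTwo` / `ResidualThetaTransportAtTwo`).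

WHY. Width seat 2's COINV door `SignedEC.signedEndCoinvariants_subsingleton_two_of_print` needs `rank_Λ Y = 1` for a finitely
generated Pontryagin-dual datum `Y` of `H = H¹(K_Σ/K_∞, E[p^∞]) = unramifiedOutside (ker κ) E[p^∞] p Σ₀`. Since
`rank_Λ Y ≤ rank_{ℤ_p} Y/TY ≤ 1` is a THEOREM under `Sel_{p^∞}(E/ℚ)` finite (`H1SigmaRank.finrank_le_coinvariantsRank` + Greenberg's
corank count `H1SigmaCorank.h1Sigma_zpCorank_le_degree_holds_rat`), the only printed input left on that line is the LOWER bound, i.e.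
«`Y` is not a torsion `Λ`-module» (Greenberg LNM 1716 p. 113: «corank_Λ H¹(F_Σ/F_∞, E[p^∞]) ≥ [F:ℚ]»). It has several sources in print —
weak Leopoldt (Kato Thm. 12.4), Greenberg's Thm. 1.7 via `Sel_∞ ⊆ H` (Coates–Greenberg + the Euler-characteristic count), the count (I1)
`relaxedSelmer_torsion_card_growth` alone (`H1SigmaGrowth.not_isTorsion_dual_h1Sigma_of_relaxedCount`), or Greenberg's twists `A_s` at
level `K` (pp. 115–117) — so the K4 chain should consume the STATEMENT, not a source. This file names it:

* `H1SigmaDualNotTorsion W p κ γ S₀` — for EVERY finitely generated `Λ`-module `Y` with a bijective `dY : Y → Hom(H, ℚ/ℤ)` satisfying the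
  two identities of the tree's dual data (`T ↦ conj_γ − 1`, constants through `ℤ_p → ℤ/p^k`; the currency of
  `Greenberg1999.prop412_noFiniteSubmodule_H1Sigma_of_rank_one` / `h1SigmaInfty_rank_eq_one`), `Y` is not `Λ`-torsion.

A `Prop`-valued PREDICATE with parameters (nothing asserted, no named fact, no instance, no notation). Consumers (sibling proof files):
`…SignedControlAtTwoOfPubTwoNotTorsionH1Sigma` (the K4 chain against this predicate) and its adapters from (I1), Thm. 1.7, weak Leopoldt.
BSD is not proved by any of this.

References: [GreenbergLNM1716] R. Greenberg, LNM 1716 (1999), §4 p. 113 («corank_Λ(H¹(F_Σ/F_∞, E[p^∞])) ≥ [F:ℚ]»), pp. 115–117, Prop. 4.12;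
[Kato2004Asterisque] Thm. 12.4.
-/

set_option autoImplicit false
-- the Theorems namespace of this sub repeats the summit name by design (D-0017 nested layout)
set_option linter.dupNamespace false

noncomputable section

open scoped NumberField

open NumberField IsDedekindDomain

universe u

namespace Summit.BirchSwinnertonDyer.BirchSwinnertonDyer.Theorems.SignedEC

open Literature.NumberTheory.EllipticCurves Literature.NumberTheory.EllipticCurves.GreenbergVatsal2000 WeierstrassCurve

/-- **«The Pontryagin dual of `H¹(K_Σ/K_∞, E[p^∞])` is not `Λ`-torsion»** for the elliptic curve `W/K`, the prime `p`, the
`ℤ_p`-extension `κ` with (topological generator) `γ`, and `Σ = Σ₀ ∪ {v ∣ p} ∪ ∞`: every finitely generated `Λ = ℤ_p⟦T⟧`-module `Y` equipped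
with a bijection `dY : Y ≅ Hom(unramifiedOutside (ker κ) E[p^∞] p Σ₀, ℚ/ℤ)` under which `T` acts as `conj_γ − 1` and the constants `ℤ_p`
through `ℤ_p → ℤ/p^k` on `p^k`-torsion classes (the two identities of the tree's Pontryagin-dual data) is NOT a torsion `Λ`-module —
Greenberg's «corank_Λ H¹(F_Σ/F_∞, E[p^∞]) ≥ [F:ℚ]» (LNM 1716 p. 113) in the tree's untopologised currency, for `[K:ℚ] ≥ 1`. A predicate
(nothing asserted). [cite: GreenbergLNM1716, §4 p. 113 and Prop. 4.12 (p. 119)] -/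
def H1SigmaDualNotTorsion {K : Type u} [Field K] [NumberField K] (W : WeierstrassCurve K) (p : ℕ) [Fact p.Prime]
    (κ : ZpExtension K p) (γ : Field.absoluteGaloisGroup K) (S₀ : Set (HeightOneSpectrum (𝓞 K))) : Prop :=
  ∀ (Y : Type u) [AddCommGroup Y] [Module (IwasawaAlgebra p) Y] [Module.Finite (IwasawaAlgebra p) Y]
    (dY : Y →+ (unramifiedOutside κ.kerSubgroup (W.geomPrimaryTorsion p) p S₀ →+ AddCircle (1 : ℚ))),
    Function.Bijective dY →
    (∀ (y : Y) (c : unramifiedOutside κ.kerSubgroup (W.geomPrimaryTorsion p) p S₀),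
      dY ((PowerSeries.X : IwasawaAlgebra p) • y) c =
        dY y ⟨W.conjH1 p κ.kerSubgroup γ c,
          conjH1_mem_unramifiedOutside κ.kerSubgroup (W.geomPrimaryTorsion p) p _ γ c.2⟩ - dY y c) →
    (∀ (a : ℤ_[p]) (y : Y) (c : unramifiedOutside κ.kerSubgroup (W.geomPrimaryTorsion p) p S₀) (k : ℕ),
      (p ^ k) • c = 0 → dY (PowerSeries.C a • y) c = (PadicInt.toZModPow k a).val • dY y c) →
    ¬ Module.IsTorsion (IwasawaAlgebra p) Y

end Summit.BirchSwinnertonDyer.BirchSwinnertonDyer.Theorems.SignedEC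

end
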